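import Literature.Analysis.FluidPDE.FluidComputer.ThresholdLevelRungs
import HarnessLib

/-!
# Fluid computer blueprint — threshold gate: one REFINEMENT PASS of the level step

HONEST FRAMING: low prior, high value-of-information experiment on Tao's machine paradigm; NOT a
claim that NS blows up. Elementary interval bookkeeping for the 5-mode circuit
`thresholdCircuit ε σ ν μ r κ` on a forced window; nothing is asserted about any fluid equation.

## What this file is (bp3 gen 12)

The level step of the transfer stage (`ThresholdLevelChain`) carries an interval box of the modes
from one trigger level `c = C` to the next `c = C'`. On the sub-window `[0, t*]` before the
trigger reaches `C'`, a box `S` of all modes valid on the whole sub-window is REFINED into a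
tighter one by evaluating the comparison envelopes of `ThresholdLevelRungs` at the endpoints of the
time range (`refine`), exactly as the numerical twin `pub-fluidc/code/thgate/bookkeep_v6.py`
(`step_w`, inner loop) does in floating point. This file defines the data (`GateData`,
`LevelEntry`, `WindowBox`), the closed-form rates of a box (`WindowBox.gℓ`, `ρℓ`, `Ψℓ`, `sℓ`,
`Λh`, `mℓ`, …), the refinement map `refine`, and proves `IsForcedWindow.refine_valid`: if `S` is
valid on `[0, τ]` (`τ ≤ h`), the entry state lies in the entry box and the side conditions of the
rungs hold for `S` (signs, `gℓ ≥ 0`, `ρℓ ≥ 0`, `Zℓ > 0`), then `refine S` is valid on `[0, τ]`.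
Iterating it is the fine part of the level step (`ThresholdLevelStep`).
[cite: Tao2016AveragedNS, §5.5 Thm 5.3 (5.5)] for the circuit; everything here is [folklore].
-/

noncomputable section

open Set Filter Topology
open scoped NNReal

namespace Literature.Analysis.FluidPDE.FluidComputer

open Literature.Analysis.FluidPDE.Tao2016AveragedNS Literature.Analysis.ODE

/-- The seven parameters of a forced threshold gate: couplings `ε σ ν μ r κ` and defect `δ`.
[folklore] -/
structure GateData where
  /-- pump coupling -/
  ε : ℝ
  /-- seed coupling -/
  σ : ℝ
  /-- trigger amplification -/
  ν : ℝ
  /-- attenuator -/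
  μ : ℝ
  /-- rotor coupling -/
  r : ℝ
  /-- drain / output coupling -/
  κ : ℝ
  /-- defect (forcing) level -/
  δ : ℝ

/-- Sign conditions on the parameters used by every rung. [folklore] -/
structure GateData.Valid (G : GateData) : Prop where
  hε : 0 ≤ G.ε
  hσ : 0 ≤ G.σ
  hν : 0 ≤ G.ν
  hμ : 0 ≤ G.μ
  hr : 0 ≤ G.r
  hκ : 0 < G.κ
  hδ : 0 ≤ G.δ

/-- **Entry box at a trigger level** (`c = C` exactly): intervals for the carrier `a`, the clock
`b`, the slaving residual `w = κdã - rca` and the output `ã`. [folklore] -/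
structure LevelEntry where
  /-- carrier floor / ceiling -/
  al : ℝ
  ah : ℝ
  /-- clock floor / ceiling -/
  bl : ℝ
  bh : ℝ
  /-- residual floor / ceiling -/
  wl : ℝ
  wh : ℝ
  /-- output floor / ceiling -/
  zl : ℝ
  zh : ℝ
  /-- energy floor / ceiling -/
  El : ℝ
  Eh : ℝ

/-- Membership of a state in the entry box at level `C`. [folklore] -/
def LevelEntry.mem (B : LevelEntry) (κ r C : ℝ) (X : Fin 5 → ℝ) : Prop :=
  (B.al ≤ X 0 ∧ X 0 ≤ B.ah) ∧ (B.bl ≤ X 1 ∧ X 1 ≤ B.bh) ∧ X 2 = C ∧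
    (B.wl ≤ slavingResidual κ r X ∧ slavingResidual κ r X ≤ B.wh) ∧ (B.zl ≤ X 4 ∧ X 4 ≤ B.zh) ∧
    (B.El ≤ energy X ∧ energy X ≤ B.Eh)

/-- **Window box**: intervals for all of `a, b, c, d, ã` and the residual `w`, meant to hold at
every time of a sub-window. [folklore] -/
structure WindowBox where
  /-- carrier -/
  Aℓ : ℝ
  Ah : ℝ
  /-- clock -/
  Bℓ : ℝ
  Bh : ℝ
  /-- trigger -/
  cℓ : ℝ
  ch : ℝ
  /-- conduit -/
  Dℓ : ℝ
  Dh : ℝ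
  /-- output -/
  Zℓ : ℝ
  Zh : ℝ
  /-- residual -/
  Wℓ : ℝ
  Wh : ℝ

namespace WindowBox

/-- Membership of a state in a window box. [folklore] -/
def mem (S : WindowBox) (κ r : ℝ) (X : Fin 5 → ℝ) : Prop :=
  (S.Aℓ ≤ X 0 ∧ X 0 ≤ S.Ah) ∧ (S.Bℓ ≤ X 1 ∧ X 1 ≤ S.Bh) ∧ (S.cℓ ≤ X 2 ∧ X 2 ≤ S.ch) ∧
    (S.Dℓ ≤ X 3 ∧ X 3 ≤ S.Dh) ∧ (S.Zℓ ≤ X 4 ∧ X 4 ≤ S.Zh) ∧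
    (S.Wℓ ≤ slavingResidual κ r X ∧ slavingResidual κ r X ≤ S.Wh)

/-- **Side conditions** under which the rungs apply to a box: signs of the floors, positive output
floor, nonnegative net-rate floor and trigger-rate floor. [folklore] -/
structure Sides (G : GateData) (S : WindowBox) : Prop where
  hA : 0 ≤ S.Aℓ
  hB : 0 ≤ S.Bℓ
  hc : 0 ≤ S.cℓ
  hD : 0 ≤ S.Dℓ
  hZ : 0 < S.Zℓ
  hg : 0 ≤ G.ν * S.Bℓ - G.μ * S.Ah
  hρ : 0 ≤ G.σ * S.Aℓ ^ 2 + (G.ν * S.Bℓ - G.μ * S.Ah) * S.cℓ - G.δ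

variable (G : GateData) (S : WindowBox)

/-- net trigger rate floor `gℓ = νBℓ - μAh` [folklore] -/
def gℓ : ℝ := G.ν * S.Bℓ - G.μ * S.Ah
/-- net trigger rate ceiling `gh = νBh - μAℓ` [folklore] -/
def gh : ℝ := G.ν * S.Bh - G.μ * S.Aℓ
/-- trigger speed floor `ρℓ = σAℓ² + gℓcℓ - δ` [folklore] -/
def ρℓ : ℝ := G.σ * S.Aℓ ^ 2 + S.gℓ G * S.cℓ - G.δ
/-- trigger speed ceiling `ρh = σAh² + gh·ch + δ` [folklore] -/
def ρh : ℝ := G.σ * S.Ah ^ 2 + S.gh G * S.ch + G.δ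
/-- source floor `Ψℓ` of the residual equation [folklore] -/
def Ψℓ : ℝ := G.κ ^ 2 * S.Dℓ ^ 3 - G.r * G.σ * S.Ah ^ 3 - G.r * S.gh G * S.Ah * S.ch +
  G.r * G.ε * S.Aℓ * S.Bℓ * S.cℓ + G.r * G.σ * S.Aℓ * S.cℓ ^ 2 - G.r * G.μ * S.ch ^ 3 +
  G.r ^ 2 * S.cℓ ^ 2 * S.Dℓ
/-- source ceiling `Ψh` of the residual equation [folklore] -/
def Ψh : ℝ := G.κ ^ 2 * S.Dh ^ 3 - G.r * G.σ * S.Aℓ ^ 3 - G.r * S.gℓ G * S.Aℓ * S.cℓ +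
  G.r * G.ε * S.Ah * S.Bh * S.ch + G.r * G.σ * S.Ah * S.ch ^ 2 - G.r * G.μ * S.cℓ ^ 3 +
  G.r ^ 2 * S.ch ^ 2 * S.Dh
/-- forcing budget of the residual equation [folklore] -/
def frc : ℝ := G.δ * (G.κ * S.Zh + G.κ * S.Dh + G.r * (S.Ah + S.ch))
/-- skew term `κ(Zh - Zℓ)max(-Wℓ, 0)` [folklore] -/
def skew : ℝ := G.κ * (S.Zh - S.Zℓ) * max (-S.Wℓ) 0
/-- total source floor `sℓ = Ψℓ - frc - skew` [folklore] -/
def sℓ : ℝ := S.Ψℓ G - S.frc G - S.skew G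
/-- total source ceiling `sh = Ψh + frc + skew` [folklore] -/
def sh : ℝ := S.Ψh G + S.frc G + S.skew G
/-- fastest carrier decay `Λh = εBh + σch + r²ch²/(κZℓ)` (floor envelope) [folklore] -/
def Λh : ℝ := G.ε * S.Bh + G.σ * S.ch + G.r ^ 2 * S.ch ^ 2 / (G.κ * S.Zℓ)
/-- slowest carrier decay `Λℓ = εBℓ + σcℓ + r²cℓ²/(κZh)` (ceiling envelope) [folklore] -/
def Λℓ : ℝ := G.ε * S.Bℓ + G.σ * S.cℓ + G.r ^ 2 * S.cℓ ^ 2 / (G.κ * S.Zh)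
/-- carrier source floor `mℓ` [folklore] -/
def mℓ : ℝ := G.μ * S.cℓ ^ 2 -
  (G.r * S.ch * max S.Wh 0 / (G.κ * S.Zℓ) - G.r * S.cℓ * max (-S.Wh) 0 / (G.κ * S.Zh)) - G.δ
/-- carrier source ceiling `mh` [folklore] -/
def mh : ℝ := G.μ * S.ch ^ 2 +
  (G.r * S.ch * max (-S.Wℓ) 0 / (G.κ * S.Zℓ) - G.r * S.cℓ * max S.Wℓ 0 / (G.κ * S.Zh)) + G.δ
/-- clock rate floor [folklore] -/
def βℓ : ℝ := G.ε * S.Aℓ ^ 2 - G.ν * S.ch ^ 2 - G.δ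
/-- clock rate ceiling [folklore] -/
def βh : ℝ := G.ε * S.Ah ^ 2 - G.ν * S.cℓ ^ 2 + G.δ
/-- output rate floor [folklore] -/
def ζℓ : ℝ := G.κ * S.Dℓ ^ 2 - G.δ
/-- output rate ceiling [folklore] -/
def ζh : ℝ := G.κ * S.Dh ^ 2 + G.δ

/-- carrier floor envelope from entry floor `al` [folklore] -/
def aFloor (al t : ℝ) : ℝ := -gronwallBound (-al) (-S.Λh G) (-S.mℓ G) t
/-- carrier ceiling envelope from entry ceiling `ah` [folklore] -/
def aCeil (ah t : ℝ) : ℝ := gronwallBound ah (-S.Λℓ G) (S.mh G) t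
/-- residual floor envelope from entry floor `wl` [folklore] -/
def wFloor (wl t : ℝ) : ℝ := -gronwallBound (-wl) (-(G.κ * S.Zh)) (-S.sℓ G) t
/-- residual ceiling envelope from entry ceiling `wh` [folklore] -/
def wCeil (wh t : ℝ) : ℝ := gronwallBound wh (-(G.κ * S.Zℓ)) (S.sh G) t

/-- **One refinement pass** (the inner loop of `bookkeep_v6.step_w`): the new box on a
sub-window of length at most `h` from level `C` to level `C'`, from the entry box `B` and a box
`S` valid on the sub-window. Floors/ceilings are intersected with those of `S`. [folklore] -/
def refine (B : LevelEntry) (h C C' : ℝ) : WindowBox :=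
  let Aℓ' := max S.Aℓ (min (S.aFloor G B.al 0) (S.aFloor G B.al h))
  let Ah' := min S.Ah (max (S.aCeil G B.ah 0) (S.aCeil G B.ah h))
  let Bℓ' := max S.Bℓ (min (B.bl + S.βℓ G * 0) (B.bl + S.βℓ G * h))
  let Bh' := min S.Bh (max (B.bh + S.βh G * 0) (B.bh + S.βh G * h))
  let cℓ' := max S.cℓ C
  let Zℓ' := max S.Zℓ (min (B.zl + S.ζℓ G * 0) (B.zl + S.ζℓ G * h))
  let Zh' := min S.Zh (max (B.zh + S.ζh G * 0) (B.zh + S.ζh G * h))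
  let Wℓ' := max S.Wℓ (min (S.wFloor G B.wl 0) (S.wFloor G B.wl h))
  let Wh' := min S.Wh (max (S.wCeil G B.wh 0) (S.wCeil G B.wh h))
  { Aℓ := Aℓ', Ah := Ah', Bℓ := Bℓ', Bh := Bh', cℓ := cℓ', ch := C',
    Dℓ := max S.Dℓ ((Wℓ' + G.r * cℓ' * Aℓ') / (G.κ * Zh')),
    Dh := min S.Dh ((Wh' + G.r * C' * Ah') / (G.κ * Zℓ')),
    Zℓ := Zℓ', Zh := Zh', Wℓ := Wℓ', Wh := Wh' }

end WindowBox

/-! ### Monotonicity of the envelopes in the initial value -/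

/-- `gronwallBound δ K ε t` is monotone in the initial value `δ`. [folklore] -/
theorem gronwallBound_mono_init {δ₁ δ₂ : ℝ} (K ε t : ℝ) (h : δ₁ ≤ δ₂) :
    gronwallBound δ₁ K ε t ≤ gronwallBound δ₂ K ε t := by
  by_cases hK : K = 0
  · subst hK; simp [gronwallBound_K0, h]
  · simp only [gronwallBound_of_K_ne_0 hK]
    have := mul_le_mul_of_nonneg_right h (Real.exp_nonneg (K * t))
    linarith

namespace IsForcedWindow

variable {G : GateData} {τ : ℝ} {x : ℝ → Fin 5 → ℝ}

/-- **ENVELOPE BOUNDS.** On a forced window `[0, τ]`: if the box `S` holds at every time of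
`[0, τ]`, its side conditions hold and the state at time `0` lies in the entry box `B` at level
`C`, then at every time `t ∈ [0, τ]` each mode lies between its comparison envelopes started from
the entry box: carrier (`aFloor`/`aCeil`), clock (affine, rates `βℓ`/`βh`), trigger (affine from
`C`, speeds `ρℓ`/`ρh`), output (affine, `ζℓ`/`ζh`) and residual (`wFloor`/`wCeil`). [folklore] -/
theorem envelope_bounds (hG : G.Valid) (hW : IsForcedWindow G.ε G.σ G.ν G.μ G.r G.κ G.δ τ x)
    {C : ℝ} {S : WindowBox} {B : LevelEntry}
    (hS : ∀ t ∈ Icc 0 τ, S.mem G.κ G.r (x t)) (hside : S.Sides G) (hB : B.mem G.κ G.r C (x 0)) :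
    ∀ t ∈ Icc 0 τ,
      (S.aFloor G B.al t ≤ x t 0 ∧ x t 0 ≤ S.aCeil G B.ah t) ∧
      (B.bl + S.βℓ G * t ≤ x t 1 ∧ x t 1 ≤ B.bh + S.βh G * t) ∧
      (C + S.ρℓ G * t ≤ x t 2 ∧ x t 2 ≤ C + S.ρh G * t) ∧
      (B.zl + S.ζℓ G * t ≤ x t 4 ∧ x t 4 ≤ B.zh + S.ζh G * t) ∧
      (S.wFloor G B.wl t ≤ slavingResidual G.κ G.r (x t) ∧
        slavingResidual G.κ G.r (x t) ≤ S.wCeil G B.wh t) := by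
  obtain ⟨hε, hσ, hν, hμ, hr, hκ, hδ⟩ := hG
  obtain ⟨hA0, hB0, hc0, hD0, hZ0, hg0, hρ0⟩ := hside
  obtain ⟨⟨hal, hah⟩, ⟨hbl, hbh⟩, hcC, ⟨hwl, hwh⟩, ⟨hzl, hzh⟩, -⟩ := hB
  -- the box on the half-open window
  have hS' : ∀ t ∈ Ico 0 τ, S.mem G.κ G.r (x t) := fun t ht => hS t (Ico_subset_Icc_self ht)
  have ha : ∀ t ∈ Ico 0 τ, S.Aℓ ≤ x t 0 ∧ x t 0 ≤ S.Ah := fun t ht => (hS' t ht).1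
  have hb : ∀ t ∈ Ico 0 τ, S.Bℓ ≤ x t 1 ∧ x t 1 ≤ S.Bh := fun t ht => (hS' t ht).2.1
  have hc : ∀ t ∈ Ico 0 τ, S.cℓ ≤ x t 2 ∧ x t 2 ≤ S.ch := fun t ht => (hS' t ht).2.2.1
  have hd : ∀ t ∈ Ico 0 τ, S.Dℓ ≤ x t 3 ∧ x t 3 ≤ S.Dh := fun t ht => (hS' t ht).2.2.2.1
  have hz : ∀ t ∈ Ico 0 τ, S.Zℓ ≤ x t 4 ∧ x t 4 ≤ S.Zh := fun t ht => (hS' t ht).2.2.2.2.1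
  have hw : ∀ t ∈ Ico 0 τ, S.Wℓ ≤ slavingResidual G.κ G.r (x t) ∧
      slavingResidual G.κ G.r (x t) ≤ S.Wh := fun t ht => (hS' t ht).2.2.2.2.2
  have hgbox : ∀ t ∈ Ico 0 τ, S.gℓ G ≤ G.ν * x t 1 - G.μ * x t 0 ∧
      G.ν * x t 1 - G.μ * x t 0 ≤ S.gh G := fun t ht => netRate_mem_of_box hν hμ (ha t ht) (hb t ht)
  have ha0' : ∀ t ∈ Ico 0 τ, 0 ≤ x t 0 := fun t ht => hA0.trans (ha t ht).1
  have hc0' : ∀ t ∈ Ico 0 τ, 0 ≤ x t 2 ∧ x t 2 ≤ S.ch := fun t ht => ⟨hc0.trans (hc t ht).1,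
    (hc t ht).2⟩
  intro t ht
  obtain ⟨⟨haℓt, haht⟩, ⟨hbℓt, hbht⟩, ⟨hcℓt, hcht⟩, -, ⟨hzℓt, hzht⟩, -⟩ := hS t ht
  have hgh : 0 ≤ S.gh G := by
    have := netRate_mem_of_box hν hμ ⟨haℓt, haht⟩ ⟨hbℓt, hbht⟩
    exact hg0.trans (this.1.trans this.2)
  refine ⟨⟨?_, ?_⟩, ?_, ⟨?_, ?_⟩, ?_, ⟨?_, ?_⟩⟩
  · -- carrier floor
    have hrot_le : ∀ s ∈ Ico 0 τ, G.r * x s 3 * x s 2 ≤ G.r ^ 2 * S.ch ^ 2 / (G.κ * S.Zℓ) * x s 0 +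
        (G.r * S.ch * max S.Wh 0 / (G.κ * S.Zℓ) - G.r * S.cℓ * max (-S.Wh) 0 / (G.κ * S.Zh)) :=
      fun s hs => rotor_le_of_slavingResidual hr hκ hc0 hZ0 (ha0' s hs) (hc s hs) (hz s hs)
        (hw s hs).2
    have h1 := hW.carrier_ge_gronwall hε hσ hμ hc0 ha0' (fun s hs => ⟨hB0.trans (hb s hs).1,
      (hb s hs).2⟩) hc hrot_le t ht
    have h2 : gronwallBound (-x 0 0) (-(G.ε * S.Bh + G.σ * S.ch + G.r ^ 2 * S.ch ^ 2 /
        (G.κ * S.Zℓ))) (-(G.μ * S.cℓ ^ 2 - (G.r * S.ch * max S.Wh 0 / (G.κ * S.Zℓ) -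
          G.r * S.cℓ * max (-S.Wh) 0 / (G.κ * S.Zh)) - G.δ)) t ≤
        gronwallBound (-B.al) (-S.Λh G) (-S.mℓ G) t :=
      gronwallBound_mono_init _ _ _ (by linarith)
    simp only [WindowBox.aFloor]
    linarith
  · -- carrier ceiling
    have hrot_ge : ∀ s ∈ Ico 0 τ, G.r ^ 2 * S.cℓ ^ 2 / (G.κ * S.Zh) * x s 0 -
        (G.r * S.ch * max (-S.Wℓ) 0 / (G.κ * S.Zℓ) - G.r * S.cℓ * max S.Wℓ 0 / (G.κ * S.Zh)) ≤
          G.r * x s 3 * x s 2 :=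
      fun s hs => rotor_ge_of_slavingResidual hr hκ hc0 hZ0 (ha0' s hs) (hc s hs) (hz s hs)
        (hw s hs).1
    have h1 := hW.carrier_le_gronwall hε hσ hμ hc0 ha0' (fun s hs => (hb s hs).1) hc hrot_ge t ht
    have h2 : gronwallBound (x 0 0) (-(G.ε * S.Bℓ + G.σ * S.cℓ + G.r ^ 2 * S.cℓ ^ 2 /
        (G.κ * S.Zh))) (G.μ * S.ch ^ 2 + (G.r * S.ch * max (-S.Wℓ) 0 / (G.κ * S.Zℓ) -
          G.r * S.cℓ * max S.Wℓ 0 / (G.κ * S.Zh)) + G.δ) t ≤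
        gronwallBound B.ah (-S.Λℓ G) (S.mh G) t :=
      gronwallBound_mono_init _ _ _ hah
    simp only [WindowBox.aCeil]
    exact h1.trans h2
  · -- clock
    have hbt := hW.clock_two_sided_lin hε hν hA0 hc0 ha hc t ht
    simp only [WindowBox.βℓ, WindowBox.βh]
    constructor <;> linarith [hbt.1, hbt.2]
  · -- trigger floor
    have h1 := hW.trigger_ge_lin hσ hA0 hc0 hg0 (fun s hs => (ha s hs).1) (fun s hs => (hc s hs).1)
      (fun s hs => (hgbox s hs).1) t ht
    rw [hcC] at h1
    simp only [WindowBox.ρℓ, WindowBox.gℓ]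
    linarith
  · -- trigger ceiling
    have h1 := hW.trigger_le_lin hσ hgh (fun s hs => ⟨ha0' s hs, (ha s hs).2⟩) hc0'
      (fun s hs => (hgbox s hs).2) t ht
    rw [hcC] at h1
    simp only [WindowBox.ρh]
    linarith
  · -- output
    have hzt := hW.output_two_sided_lin hκ.le hD0 hd t ht
    simp only [WindowBox.ζℓ, WindowBox.ζh]
    constructor <;> linarith [hzt.1, hzt.2]
  · -- residual floor
    have h1 := hW.slavingResidual_ge hε hσ hμ hr hκ.le hA0 hB0 hc0 hD0 hZ0.le hg0 ha hb hc hd hz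
      hgbox (fun s hs => (hw s hs).1) t ht
    have h2 : gronwallBound (-slavingResidual G.κ G.r (x 0)) (-(G.κ * S.Zh))
        (-(G.κ ^ 2 * S.Dℓ ^ 3 - G.r * G.σ * S.Ah ^ 3 - G.r * S.gh G * S.Ah * S.ch +
          G.r * G.ε * S.Aℓ * S.Bℓ * S.cℓ + G.r * G.σ * S.Aℓ * S.cℓ ^ 2 - G.r * G.μ * S.ch ^ 3 +
          G.r ^ 2 * S.cℓ ^ 2 * S.Dℓ - G.δ * (G.κ * S.Zh + G.κ * S.Dh + G.r * (S.Ah + S.ch)) -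
          G.κ * (S.Zh - S.Zℓ) * max (-S.Wℓ) 0)) t ≤
        gronwallBound (-B.wl) (-(G.κ * S.Zh)) (-S.sℓ G) t := by
      have : -S.sℓ G = -(G.κ ^ 2 * S.Dℓ ^ 3 - G.r * G.σ * S.Ah ^ 3 - G.r * S.gh G * S.Ah * S.ch +
          G.r * G.ε * S.Aℓ * S.Bℓ * S.cℓ + G.r * G.σ * S.Aℓ * S.cℓ ^ 2 - G.r * G.μ * S.ch ^ 3 +
          G.r ^ 2 * S.cℓ ^ 2 * S.Dℓ - G.δ * (G.κ * S.Zh + G.κ * S.Dh + G.r * (S.Ah + S.ch)) -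
          G.κ * (S.Zh - S.Zℓ) * max (-S.Wℓ) 0) := by
        simp only [WindowBox.sℓ, WindowBox.Ψℓ, WindowBox.frc, WindowBox.skew]
      rw [this]
      exact gronwallBound_mono_init _ _ _ (by linarith)
    simp only [WindowBox.wFloor]
    linarith
  · -- residual ceiling
    have h1 := hW.slavingResidual_le hε hσ hμ hr hκ.le hA0 hB0 hc0 hD0 hZ0.le hg0 ha hb hc hd hz
      hgbox (fun s hs => (hw s hs).1) t ht
    have h2 : gronwallBound (slavingResidual G.κ G.r (x 0)) (-(G.κ * S.Zℓ))
        (G.κ ^ 2 * S.Dh ^ 3 - G.r * G.σ * S.Aℓ ^ 3 - G.r * S.gℓ G * S.Aℓ * S.cℓ +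
          G.r * G.ε * S.Ah * S.Bh * S.ch + G.r * G.σ * S.Ah * S.ch ^ 2 - G.r * G.μ * S.cℓ ^ 3 +
          G.r ^ 2 * S.ch ^ 2 * S.Dh + G.δ * (G.κ * S.Zh + G.κ * S.Dh + G.r * (S.Ah + S.ch)) +
          G.κ * (S.Zh - S.Zℓ) * max (-S.Wℓ) 0) t ≤
        gronwallBound B.wh (-(G.κ * S.Zℓ)) (S.sh G) t := by
      have : S.sh G = G.κ ^ 2 * S.Dh ^ 3 - G.r * G.σ * S.Aℓ ^ 3 - G.r * S.gℓ G * S.Aℓ * S.cℓ +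
          G.r * G.ε * S.Ah * S.Bh * S.ch + G.r * G.σ * S.Ah * S.ch ^ 2 - G.r * G.μ * S.cℓ ^ 3 +
          G.r ^ 2 * S.ch ^ 2 * S.Dh + G.δ * (G.κ * S.Zh + G.κ * S.Dh + G.r * (S.Ah + S.ch)) +
          G.κ * (S.Zh - S.Zℓ) * max (-S.Wℓ) 0 := by
        simp only [WindowBox.sh, WindowBox.Ψh, WindowBox.frc, WindowBox.skew]
      rw [this]
      exact gronwallBound_mono_init _ _ _ hwh
    simp only [WindowBox.wCeil]
    exact h1.trans h2

/-- Endpoint bracketing of a floor envelope `-gronwallBound`. [folklore] -/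
theorem min_neg_gronwallBound_le (δ' K ε' : ℝ) {t₁ t₂ t : ℝ} (ht : t ∈ Icc t₁ t₂) :
    min (-gronwallBound δ' K ε' t₁) (-gronwallBound δ' K ε' t₂) ≤ -gronwallBound δ' K ε' t := by
  have := (gronwallBound_mem_endpoints δ' K ε' ht).2
  rcases le_total (gronwallBound δ' K ε' t₁) (gronwallBound δ' K ε' t₂) with hle | hle
  · rw [max_eq_right hle] at this; exact (min_le_right _ _).trans (by linarith)
  · rw [max_eq_left hle] at this; exact (min_le_left _ _).trans (by linarith)

/-- **Conduit box from the other boxes, in the one-sided form used by the bookkeeping**: with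
`d ≥ Dℓ₀ ≥ 0` known, `d ≥ max Dℓ₀ ((Wℓ + r cℓ Aℓ)/(κ Zh))` and `d ≤ (Wh + r ch Ah)/(κ Zℓ)`.
[folklore] -/
theorem conduit_mem_of_boxes {κ r : ℝ} (hr : 0 ≤ r) (hκ : 0 < κ)
    {Aℓ Ah cℓ ch Zℓ Zh Wℓ Wh Dℓ₀ : ℝ} (hAℓ : 0 ≤ Aℓ) (hcℓ : 0 ≤ cℓ) (hZℓ : 0 < Zℓ) (hDℓ₀ : 0 ≤ Dℓ₀)
    {X : Fin 5 → ℝ} (ha : Aℓ ≤ X 0 ∧ X 0 ≤ Ah) (hc : cℓ ≤ X 2 ∧ X 2 ≤ ch)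
    (hz : Zℓ ≤ X 4 ∧ X 4 ≤ Zh) (hw : Wℓ ≤ slavingResidual κ r X ∧ slavingResidual κ r X ≤ Wh)
    (hd : Dℓ₀ ≤ X 3) :
    max Dℓ₀ ((Wℓ + r * cℓ * Aℓ) / (κ * Zh)) ≤ X 3 ∧ X 3 ≤ (Wh + r * ch * Ah) / (κ * Zℓ) := by
  have hdd := conduit_bounds_of_slavingResidual hr hκ hAℓ hcℓ hZℓ ha hc hz hw
  have hZℓh : Zℓ ≤ Zh := hz.1.trans hz.2
  have hκZℓ : 0 < κ * Zℓ := mul_pos hκ hZℓ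
  have hκZh : 0 < κ * Zh := mul_pos hκ (hZℓ.trans_le hZℓh)
  have hmon : κ * Zℓ ≤ κ * Zh := mul_le_mul_of_nonneg_left hZℓh hκ.le
  constructor
  · refine max_le hd ?_
    rcases le_or_gt 0 (Wℓ + r * cℓ * Aℓ) with hs | hs
    · have hmin : min ((Wℓ + r * cℓ * Aℓ) / (κ * Zh)) ((Wℓ + r * cℓ * Aℓ) / (κ * Zℓ)) =
          (Wℓ + r * cℓ * Aℓ) / (κ * Zh) := min_eq_left (div_le_div_of_nonneg_left hs hκZℓ hmon)
      rw [← hmin]; exact hdd.1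
    · have : (Wℓ + r * cℓ * Aℓ) / (κ * Zh) < 0 := div_neg_of_neg_of_pos hs hκZh
      linarith [hDℓ₀.trans hd]
  · rcases le_or_gt 0 (Wh + r * ch * Ah) with hs | hs
    · have hmax : max ((Wh + r * ch * Ah) / (κ * Zℓ)) ((Wh + r * ch * Ah) / (κ * Zh)) =
          (Wh + r * ch * Ah) / (κ * Zℓ) := max_eq_left (div_le_div_of_nonneg_left hs hκZℓ hmon)
      rw [← hmax]; exact hdd.2
    · exfalso
      have h2 : (Wh + r * ch * Ah) / (κ * Zℓ) < 0 := div_neg_of_neg_of_pos hs hκZℓ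
      have h3 : (Wh + r * ch * Ah) / (κ * Zh) < 0 := div_neg_of_neg_of_pos hs hκZh
      have h4 := max_lt h2 h3
      linarith [hDℓ₀.trans hd, hdd.2]

/-- **VALIDITY OF ONE REFINEMENT PASS.** On a forced window `[0, τ]` with `0 ≤ τ ≤ h`: if the box
`S` holds at every time of `[0, τ]`, its side conditions hold, the state at time `0` lies in the
entry box `B` at level `C`, and the trigger stays `≤ C'` on `[0, τ]`, then the refined box
`S.refine G B h C C'` holds at every time of `[0, τ]`. [folklore] -/
theorem refine_valid (hG : G.Valid) (hW : IsForcedWindow G.ε G.σ G.ν G.μ G.r G.κ G.δ τ x)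
    {h C C' : ℝ} (hτh : τ ≤ h) {S : WindowBox} {B : LevelEntry}
    (hS : ∀ t ∈ Icc 0 τ, S.mem G.κ G.r (x t)) (hside : S.Sides G)
    (hB : B.mem G.κ G.r C (x 0)) (hpre : ∀ t ∈ Icc 0 τ, x t 2 ≤ C') :
    ∀ t ∈ Icc 0 τ, (S.refine G B h C C').mem G.κ G.r (x t) := by
  have henv := hW.envelope_bounds hG hS hside hB
  obtain ⟨-, -, -, -, hr, hκ, -⟩ := hG
  obtain ⟨hA0, -, hc0, hD0, hZ0, -, hρ0⟩ := hside
  intro t ht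
  have hth : t ∈ Icc 0 h := ⟨ht.1, ht.2.trans hτh⟩
  obtain ⟨⟨haℓt, haht⟩, ⟨hbℓt, hbht⟩, ⟨hcℓt, hcht⟩, ⟨hdℓt, hdht⟩, ⟨hzℓt, hzht⟩, ⟨hwℓt, hwht⟩⟩ :=
    hS t ht
  obtain ⟨⟨haF, haC⟩, ⟨hbF, hbC⟩, ⟨hcF, -⟩, ⟨hzF, hzC⟩, ⟨hwF, hwC⟩⟩ := henv t ht
  -- endpoint bracketing on `[0, h]`
  have hA' : max S.Aℓ (min (S.aFloor G B.al 0) (S.aFloor G B.al h)) ≤ x t 0 ∧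
      x t 0 ≤ min S.Ah (max (S.aCeil G B.ah 0) (S.aCeil G B.ah h)) := by
    refine ⟨max_le haℓt ?_, le_min haht ?_⟩
    · exact (min_neg_gronwallBound_le _ _ _ hth).trans haF
    · exact haC.trans (gronwallBound_mem_endpoints B.ah (-S.Λℓ G) (S.mh G) hth).2
  have hB' : max S.Bℓ (min (B.bl + S.βℓ G * 0) (B.bl + S.βℓ G * h)) ≤ x t 1 ∧
      x t 1 ≤ min S.Bh (max (B.bh + S.βh G * 0) (B.bh + S.βh G * h)) :=
    ⟨max_le hbℓt ((affine_mem_endpoints B.bl (S.βℓ G) hth).1.trans hbF),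
      le_min hbht (hbC.trans (affine_mem_endpoints B.bh (S.βh G) hth).2)⟩
  have hc' : max S.cℓ C ≤ x t 2 ∧ x t 2 ≤ C' := by
    refine ⟨max_le hcℓt ?_, hpre t ht⟩
    have : 0 ≤ S.ρℓ G * t := mul_nonneg hρ0 ht.1
    linarith
  have hZ' : max S.Zℓ (min (B.zl + S.ζℓ G * 0) (B.zl + S.ζℓ G * h)) ≤ x t 4 ∧
      x t 4 ≤ min S.Zh (max (B.zh + S.ζh G * 0) (B.zh + S.ζh G * h)) :=
    ⟨max_le hzℓt ((affine_mem_endpoints B.zl (S.ζℓ G) hth).1.trans hzF),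
      le_min hzht (hzC.trans (affine_mem_endpoints B.zh (S.ζh G) hth).2)⟩
  have hW' : max S.Wℓ (min (S.wFloor G B.wl 0) (S.wFloor G B.wl h)) ≤
      slavingResidual G.κ G.r (x t) ∧ slavingResidual G.κ G.r (x t) ≤
        min S.Wh (max (S.wCeil G B.wh 0) (S.wCeil G B.wh h)) := by
    refine ⟨max_le hwℓt ?_, le_min hwht ?_⟩
    · exact (min_neg_gronwallBound_le _ _ _ hth).trans hwF
    · exact hwC.trans (gronwallBound_mem_endpoints B.wh (-(G.κ * S.Zℓ)) (S.sh G) hth).2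
  -- conduit from the primed boxes
  have hA'0 : 0 ≤ max S.Aℓ (min (S.aFloor G B.al 0) (S.aFloor G B.al h)) :=
    hA0.trans (le_max_left _ _)
  have hc'0 : 0 ≤ max S.cℓ C := hc0.trans (le_max_left _ _)
  have hZ'0 : 0 < max S.Zℓ (min (B.zl + S.ζℓ G * 0) (B.zl + S.ζℓ G * h)) :=
    hZ0.trans_le (le_max_left _ _)
  have hD' := conduit_mem_of_boxes hr hκ hA'0 hc'0 hZ'0 hD0 hA' hc' hZ' hW' hdℓt
  exact ⟨hA', hB', hc', ⟨hD'.1, le_min hdht hD'.2⟩, hZ', hW'⟩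

end IsForcedWindow

end Literature.Analysis.FluidPDE.FluidComputer

end
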